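import Literature.Analysis.Complex.HormanderInterpolation
import Literature.Analysis.Complex.OsgoodProofs
import HarnessLib

/-!
# Flat-holomorphic functions on a Riemann domain: smoothness, Levi forms, exhaustions

Layer `Literature/Analysis/Complex`. A function `W : D → ℂ` on a flat Riemann domain
`proj : D → ℂ^ι` (`RiemannDomain`) is *flat-holomorphic* (`RiemannDomain.IsFlatHolomorphic`) when it
is holomorphic along every local inverse of `proj` — the shape in which
`RiemannDomain.exists_flatHolomorphic_interpolating` (`HormanderInterpolation`) produces functions
and in which the regular functions of an étale chart arrive. This file records the calculus used to
feed such functions back into Hörmander's `L²` machinery (Hörmander, *An Introduction to Complex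
Analysis in Several Variables* (1973), §2.6 and Thm. 5.4.2 ff.: holomorphic functions give the
plurisubharmonic exhaustions and weights of a Stein Riemann domain):

* `IsFlatHolomorphic.contMDiff` — flat-holomorphic functions are `C^∞` (Osgood's lemma, the tree's
  `SCV.analyticOnNhd_of_differentiableOn`); `dbar v W = 0`, `del v W = DW(v)`;
  closure under `+`, `*`, constants, finite sums, and the coordinates `proj_k`;
* `IsFlatHolomorphic.re_levi_normSq` — **the Levi form of `|W|²` is `|DW(v)|²`**:
  `Re ∑ ∂_j ∂̄_k |W|² v_j v̄_k = |∑_j ∂_j W v_j|²`;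
* `re_levi_sum_normSq_ge` — for finitely many flat-holomorphic `W_m` containing the coordinate
  functions, `s = ∑ |W_m|²` has `Re ∑ s_{jk̄} v_j v̄_k ≥ |v|²`, is `C^∞`, and has compact sublevel
  sets as soon as `t ↦ (W_m t)_m` is proper (`isCompact_sublevel_sum_normSq`): the strictly
  plurisubharmonic exhaustion of a Riemann domain spread over a Stein space;
* `re_levi_logWeight_ge` — the weight `φ₀ = log(1 + |proj|²)` is `C^∞` with
  `Re ∑ (φ₀)_{jk̄} v_j v̄_k ≥ |v|²/(1 + |proj|²)²` (from `re_levi_pointWeight_ge`).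

Everything is proved; there are no named facts.

## References

* L. Hörmander, *An Introduction to Complex Analysis in Several Variables*, North-Holland (1973),
  Thm. 2.2.1/2.2.6 (Osgood), §2.6, Thm. 4.4.3–4.4.4, §5.4. [HormanderSCV1973]

#harness_tags complex_analysis.several_variables, complex_analysis.plurisubharmonic, complex_geometry.riemann_existence
-/

noncomputable section

open scoped Manifold ContDiff Topology ComplexConjugate
open Set Filter Function Complex Metric

namespace Literature.Analysis.Complex

namespace RiemannDomain

universe u

variable {ι : Type} [Fintype ι] {D : RiemannDomain.{u} ι}

/-- **Flat-holomorphic functions** on a Riemann domain: holomorphic along every local inverse of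
`proj`. [cite: HormanderSCV1973, §5.4 (holomorphic functions on a Riemann domain)] -/
structure IsFlatHolomorphic (D : RiemannDomain.{u} ι) (W : D → ℂ) : Prop where
  /-- `W ∘ e⁻¹` is holomorphic on the target of every local inverse `e` of `proj` -/
  differentiableOn : ∀ e : OpenPartialHomeomorph D (ι → ℂ), ⇑e = D.proj → DifferentiableOn ℂ (W ∘ e.symm) e.target

namespace IsFlatHolomorphic

variable {W W' : D → ℂ}

/-- In the flat chart at `x`, a flat-holomorphic function is complex differentiable at `proj x`.
[folklore] -/
theorem differentiableAt (hW : IsFlatHolomorphic D W) (x : D) :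
    DifferentiableAt ℂ (W ∘ (D.chart x).symm) (D.proj x) :=
  (hW.differentiableOn _ (D.coe_chart x)).differentiableAt
    ((D.chart x).open_target.mem_nhds (D.proj_mem_chart_target x))

/-- **Pointwise criterion**: `W` is flat-holomorphic as soon as it is complex differentiable at
`proj x` in the flat chart at `x`, for every `x`. [folklore] -/
theorem of_differentiableAt (h : ∀ x, DifferentiableAt ℂ (W ∘ (D.chart x).symm) (D.proj x)) :
    IsFlatHolomorphic D W := by
  refine ⟨fun e he z hz ↦ ?_⟩
  set x := e.symm z with hx
  have hxs : x ∈ e.source := e.map_target hz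
  have hz' : D.proj x = z := D.proj_symm_apply he hz
  have heq := D.comp_symm_eventuallyEq W (D.coe_chart x) he (D.mem_chart_source x) hxs
  rw [hz'] at heq
  have h1 : DifferentiableAt ℂ (W ∘ (D.chart x).symm) z := hz' ▸ h x
  exact (h1.congr_of_eventuallyEq heq.symm).differentiableWithinAt

/-- **Local criterion**: `W` is flat-holomorphic as soon as every point lies in the source of SOME
local inverse `e` of `proj` with `W ∘ e⁻¹` holomorphic on `e.target`. [folklore] -/
theorem of_local (h : ∀ x : D, ∃ e : OpenPartialHomeomorph D (ι → ℂ), ⇑e = D.proj ∧ x ∈ e.source ∧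
      DifferentiableOn ℂ (W ∘ e.symm) e.target) : IsFlatHolomorphic D W := by
  refine of_differentiableAt fun x ↦ ?_
  obtain ⟨e, he, hx, hd⟩ := h x
  have hmem : D.proj x ∈ e.target := by rw [← he]; exact e.map_source hx
  have h1 : DifferentiableAt ℂ (W ∘ e.symm) (D.proj x) := hd.differentiableAt (e.open_target.mem_nhds hmem)
  exact h1.congr_of_eventuallyEq (D.comp_symm_eventuallyEq W (D.coe_chart x) he (D.mem_chart_source x) hx)

/-- A flat-holomorphic function is analytic in every flat chart. [cite: HormanderSCV1973, Thm 2.2.1 and Thm 2.2.6] -/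
theorem analyticAt (hW : IsFlatHolomorphic D W) (x : D) : AnalyticAt ℂ (W ∘ (D.chart x).symm) (D.proj x) :=
  SCV.analyticAt_of_differentiableOn (hW.differentiableOn _ (D.coe_chart x)) (D.chart x).open_target
    (D.proj_mem_chart_target x)

/-- **Flat-holomorphic functions are `C^∞`.** [cite: HormanderSCV1973, Thm 2.2.1 and Thm 2.2.6] -/
theorem contMDiff (hW : IsFlatHolomorphic D W) : ContMDiff 𝓘(ℝ, ι → ℂ) 𝓘(ℝ, ℂ) ∞ W := by
  rw [contMDiff_iff]
  intro x
  have han : AnalyticOnNhd ℂ (W ∘ (D.chart x).symm) (D.chart x).target :=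
    SCV.analyticOnNhd_of_differentiableOn (hW.differentiableOn _ (D.coe_chart x)) (D.chart x).open_target
  exact (han.contDiffOn_of_completeSpace (n := ∞)).restrict_scalars ℝ

/-- Flat-holomorphic functions are continuous. [folklore] -/
theorem continuous (hW : IsFlatHolomorphic D W) : Continuous W := hW.contMDiff.continuous

/-- `∂̄_v W = 0`. [folklore] -/
theorem dbar_eq_zero (hW : IsFlatHolomorphic D W) (v : ι → ℂ) (x : D) : dbar v W x = 0 :=
  dbarAlong_eq_zero_of_differentiableAt (hW.differentiableAt x) v

/-- `∂_v W = DW(v)`. [folklore] -/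
theorem del_eq (hW : IsFlatHolomorphic D W) (v : ι → ℂ) (x : D) : del v W x = fderivF W x v := by
  rw [← del_add_dbar, hW.dbar_eq_zero, add_zero]

/-- The real derivative of a flat-holomorphic function is its complex derivative. [folklore] -/
theorem fderivF_eq (hW : IsFlatHolomorphic D W) (x : D) :
    fderivF W x = (fderiv ℂ (W ∘ (D.chart x).symm) (D.proj x)).restrictScalars ℝ := by
  rw [fderivF, (hW.differentiableAt x).fderiv_restrictScalars ℝ]

/-- `DW` is complex linear: `DW(∑ v_j e_j) = ∑ v_j ∂_j W`. [folklore] -/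
theorem fderivF_apply_eq_sum [DecidableEq ι] (hW : IsFlatHolomorphic D W) (x : D) (v : ι → ℂ) :
    fderivF W x v = ∑ j, v j * del (Pi.single j 1) W x := by
  simp_rw [hW.del_eq, hW.fderivF_eq, ContinuousLinearMap.coe_restrictScalars']
  set L := fderiv ℂ (W ∘ (D.chart x).symm) (D.proj x)
  conv_lhs => rw [show v = ∑ j, v j • (Pi.single j (1 : ℂ) : ι → ℂ) from by
    ext k; simp [Finset.sum_apply, Pi.single_apply]]
  rw [_root_.map_sum]
  exact Finset.sum_congr rfl fun j _ ↦ by rw [L.map_smul, smul_eq_mul]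

/-- Constants are flat-holomorphic. [folklore] -/
theorem const (c : ℂ) : IsFlatHolomorphic D fun _ ↦ c :=
  ⟨fun _ _ ↦ differentiableOn_const c⟩

/-- The coordinates `proj_k` are flat-holomorphic. [folklore] -/
theorem proj_apply (k : ι) : IsFlatHolomorphic D fun y ↦ D.proj y k := by
  refine ⟨fun e he ↦ ?_⟩
  have : (fun y ↦ D.proj y k) ∘ e.symm = fun z ↦ (e (e.symm z)) k := by funext z; simp [he]
  rw [this]
  exact (differentiableOn_apply (𝕜 := ℂ) k _).congr fun z hz ↦ by simp only [e.right_inv hz]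

/-- Sums of flat-holomorphic functions are flat-holomorphic. [folklore] -/
theorem add (hW : IsFlatHolomorphic D W) (hW' : IsFlatHolomorphic D W') : IsFlatHolomorphic D fun y ↦ W y + W' y :=
  ⟨fun e he ↦ (hW.differentiableOn e he).add (hW'.differentiableOn e he)⟩

/-- Products of flat-holomorphic functions are flat-holomorphic. [folklore] -/
theorem mul (hW : IsFlatHolomorphic D W) (hW' : IsFlatHolomorphic D W') : IsFlatHolomorphic D fun y ↦ W y * W' y :=
  ⟨fun e he ↦ (hW.differentiableOn e he).mul (hW'.differentiableOn e he)⟩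

/-- Negatives of flat-holomorphic functions are flat-holomorphic. [folklore] -/
theorem neg (hW : IsFlatHolomorphic D W) : IsFlatHolomorphic D fun y ↦ -W y :=
  ⟨fun e he ↦ (hW.differentiableOn e he).neg⟩

/-- Differences of flat-holomorphic functions are flat-holomorphic. [folklore] -/
theorem sub (hW : IsFlatHolomorphic D W) (hW' : IsFlatHolomorphic D W') : IsFlatHolomorphic D fun y ↦ W y - W' y :=
  ⟨fun e he ↦ (hW.differentiableOn e he).sub (hW'.differentiableOn e he)⟩

/-- Finite sums of flat-holomorphic functions are flat-holomorphic. [folklore] -/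
theorem sum {α : Type*} (S : Finset α) {f : α → D → ℂ} (hf : ∀ a ∈ S, IsFlatHolomorphic D (f a)) :
    IsFlatHolomorphic D fun y ↦ ∑ a ∈ S, f a y :=
  ⟨fun e he ↦ by
    have : (fun y ↦ ∑ a ∈ S, f a y) ∘ e.symm = fun z ↦ ∑ a ∈ S, (f a ∘ e.symm) z := by funext z; simp
    rw [this]
    exact DifferentiableOn.fun_sum fun a ha ↦ (hf a ha).differentiableOn e he⟩

/-- Finite products of flat-holomorphic functions are flat-holomorphic. [folklore] -/
theorem prod {α : Type*} (S : Finset α) {f : α → D → ℂ} (hf : ∀ a ∈ S, IsFlatHolomorphic D (f a)) :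
    IsFlatHolomorphic D fun y ↦ ∏ a ∈ S, f a y := by
  classical
  induction S using Finset.induction_on with
  | empty => simpa using const 1
  | insert a S ha ih =>
    have h := (hf a (Finset.mem_insert_self a S)).mul (ih fun b hb ↦ hf b (Finset.mem_insert_of_mem hb))
    simpa only [Finset.prod_insert ha] using h

/-- Powers of flat-holomorphic functions are flat-holomorphic. [folklore] -/
theorem pow (hW : IsFlatHolomorphic D W) (n : ℕ) : IsFlatHolomorphic D fun y ↦ W y ^ n :=
  ⟨fun e he ↦ (hW.differentiableOn e he).pow n⟩

/-- **The derivative of a flat-holomorphic function is flat-holomorphic**: `∂_v W` is again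
holomorphic along every local inverse of `proj`. [folklore] -/
theorem del (hW : IsFlatHolomorphic D W) (v : ι → ℂ) : IsFlatHolomorphic D (del v W) := by
  refine of_differentiableAt fun x ↦ ?_
  -- near `proj x`, `∂_v W ∘ chart⁻¹ = D(W ∘ chart⁻¹)(·)(v)`
  have heq : RiemannDomain.del v W ∘ (D.chart x).symm =ᶠ[𝓝 (D.proj x)]
      fun z ↦ fderiv ℂ (W ∘ (D.chart x).symm) z v := by
    filter_upwards [(D.chart x).open_target.mem_nhds (D.proj_mem_chart_target x)] with z hz
    rw [comp_apply, del_comp_symm (D.coe_chart x) hz, delAlong_apply]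
    have hd : DifferentiableAt ℂ (W ∘ (D.chart x).symm) z :=
      (hW.differentiableOn _ (D.coe_chart x)).differentiableAt ((D.chart x).open_target.mem_nhds hz)
    rw [hd.fderiv_restrictScalars ℝ]
    simp only [ContinuousLinearMap.coe_restrictScalars', ContinuousLinearMap.map_smul, smul_eq_mul]
    rw [← mul_assoc, I_mul_I]; ring
  have hd : DifferentiableAt ℂ (fun z ↦ fderiv ℂ (W ∘ (D.chart x).symm) z v) (D.proj x) :=
    (hW.analyticAt x).fderiv.differentiableAt.clm_apply (differentiableAt_const v)
  exact hd.congr_of_eventuallyEq heq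

/-! ### The Levi form of `|W|²` -/

/-- `∂_a conj(G) = 0` for flat-holomorphic `G`. [folklore] -/
theorem del_conj_eq_zero {G : D → ℂ} (hG : IsFlatHolomorphic D G) (a : ι → ℂ) (x : D) :
    RiemannDomain.del a (fun y ↦ conj (G y)) x = 0 := by
  rw [← Weights.conj_dbar, hG.dbar_eq_zero, map_zero]

/-- `∂̄_b |W|² = W · conj(∂_b W)` for flat-holomorphic `W`. [folklore] -/
theorem dbar_normSq (hW : IsFlatHolomorphic D W) (b : ι → ℂ) (x : D) :
    dbar b (fun y ↦ ((‖W y‖ ^ 2 : ℝ) : ℂ)) x = W x * conj (RiemannDomain.del b W x) := by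
  have hfun : (fun y ↦ ((‖W y‖ ^ 2 : ℝ) : ℂ)) = fun y ↦ W y * conj (W y) := by
    funext y; rw [mul_conj', ofReal_pow]
  rw [hfun, dbar_mul_apply hW.contMDiff (contMDiff_conj_comp hW.contMDiff), dbar_conj, hW.dbar_eq_zero, zero_mul, add_zero]

/-- **The complex Hessian of `|W|²`**: `∂_a ∂̄_b |W|² = ∂_a W · conj(∂_b W)` for flat-holomorphic `W`.
[cite: HormanderSCV1973, §2.6 (plurisubharmonicity of `|f|²`)] -/
theorem del_dbar_normSq (hW : IsFlatHolomorphic D W) (a b : ι → ℂ) (x : D) :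
    RiemannDomain.del a (dbar b (fun y ↦ ((‖W y‖ ^ 2 : ℝ) : ℂ))) x =
      RiemannDomain.del a W x * conj (RiemannDomain.del b W x) := by
  have h1 : dbar b (fun y ↦ ((‖W y‖ ^ 2 : ℝ) : ℂ)) = fun y ↦ W y * conj (RiemannDomain.del b W y) := by
    funext y; exact hW.dbar_normSq b y
  rw [h1, del_mul_apply hW.contMDiff (contMDiff_conj_comp (hW.del b).contMDiff), del_conj_eq_zero (hW.del b),
    mul_zero, zero_add]

/-- **The Levi form of `|W|²` is `|DW(v)|²`.** [cite: HormanderSCV1973, §2.6] -/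
theorem re_levi_normSq [DecidableEq ι] (hW : IsFlatHolomorphic D W) (x : D) (v : ι → ℂ) :
    (∑ j, ∑ k, RiemannDomain.del (Pi.single j 1) (dbar (Pi.single k 1) (fun y ↦ ((‖W y‖ ^ 2 : ℝ) : ℂ))) x *
      v j * conj (v k)).re = ‖fderivF W x v‖ ^ 2 := by
  simp_rw [hW.del_dbar_normSq]
  have hsum : ∑ j, ∑ k, RiemannDomain.del (Pi.single j 1) W x * conj (RiemannDomain.del (Pi.single k 1) W x) * v j * conj (v k) =
      (∑ j, v j * RiemannDomain.del (Pi.single j 1) W x) * conj (∑ k, v k * RiemannDomain.del (Pi.single k 1) W x) := by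
    rw [_root_.map_sum, Finset.sum_mul]
    refine Finset.sum_congr rfl fun j _ ↦ ?_
    rw [Finset.mul_sum]
    exact Finset.sum_congr rfl fun k _ ↦ by rw [map_mul]; ring
  rw [hsum, ← hW.fderivF_apply_eq_sum, mul_conj', ← ofReal_pow, ofReal_re]

end IsFlatHolomorphic

/-! ### The exhaustion `∑ |W_m|²` -/

section Exhaustion

variable {M : Type*} [Fintype M] {W : M → D → ℂ}

/-- `∑_m |W_m|²` is `C^∞` for flat-holomorphic `W_m`. [folklore] -/
theorem contMDiff_sum_normSq (hW : ∀ m, IsFlatHolomorphic D (W m)) :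
    ContMDiff 𝓘(ℝ, ι → ℂ) 𝓘(ℝ, ℝ) ∞ fun y ↦ ∑ m, ‖W m y‖ ^ 2 :=
  contMDiff_finsetSum fun m _ ↦ (contDiff_norm_sq ℝ (n := ∞)).comp_contMDiff (hW m).contMDiff

/-- The complexified `∑_m |W_m|²`, termwise. [folklore] -/
theorem ofReal_sum_normSq (y : D) : (((∑ m, ‖W m y‖ ^ 2 : ℝ)) : ℂ) = ∑ m, ((‖W m y‖ ^ 2 : ℝ) : ℂ) := by
  push_cast; rfl

/-- **The Levi form of `s = ∑_m |W_m|²` is `∑_m |DW_m(v)|²`.** [cite: HormanderSCV1973, §2.6] -/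
theorem re_levi_sum_normSq [DecidableEq ι] (hW : ∀ m, IsFlatHolomorphic D (W m)) (x : D) (v : ι → ℂ) :
    (∑ j, ∑ k, del (Pi.single j 1) (dbar (Pi.single k 1) (fun y ↦ ((∑ m, ‖W m y‖ ^ 2 : ℝ) : ℂ))) x *
      v j * conj (v k)).re = ∑ m, ‖fderivF (W m) x v‖ ^ 2 := by
  have hfun : (fun y ↦ ((∑ m, ‖W m y‖ ^ 2 : ℝ) : ℂ)) = fun y ↦ ∑ m, ((‖W m y‖ ^ 2 : ℝ) : ℂ) := by
    funext y; push_cast; rfl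
  have hsm : ∀ m, ContMDiff 𝓘(ℝ, ι → ℂ) 𝓘(ℝ, ℂ) ∞ fun y ↦ ((‖W m y‖ ^ 2 : ℝ) : ℂ) := fun m ↦
    contMDiff_ofReal ((contDiff_norm_sq ℝ (n := ∞)).comp_contMDiff (hW m).contMDiff)
  have hjk : ∀ j k, del (Pi.single j 1) (dbar (Pi.single k 1) (fun y ↦ ((∑ m, ‖W m y‖ ^ 2 : ℝ) : ℂ))) x =
      ∑ m, del (Pi.single j 1) (dbar (Pi.single k 1) (fun y ↦ ((‖W m y‖ ^ 2 : ℝ) : ℂ))) x := by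
    intro j k
    rw [hfun]
    have h1 : dbar (Pi.single k 1) (fun y ↦ ∑ m, ((‖W m y‖ ^ 2 : ℝ) : ℂ)) =
        fun y ↦ ∑ m, dbar (Pi.single k 1) (fun y ↦ ((‖W m y‖ ^ 2 : ℝ) : ℂ)) y := by
      funext y
      exact dbar_finset_sum _ (fun m _ ↦ hsm m) _ y
    rw [h1, del_finset_sum _ (fun m _ ↦ contMDiff_dbar (hsm m) _)]
  simp_rw [hjk]
  have hswap : ∑ j : ι, ∑ k : ι, (∑ m : M, del (Pi.single j 1) (dbar (Pi.single k 1) (fun y ↦ ((‖W m y‖ ^ 2 : ℝ) : ℂ))) x) * v j * conj (v k) =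
      ∑ m : M, ∑ j : ι, ∑ k : ι, del (Pi.single j 1) (dbar (Pi.single k 1) (fun y ↦ ((‖W m y‖ ^ 2 : ℝ) : ℂ))) x * v j * conj (v k) := by
    simp_rw [Finset.sum_mul]
    calc ∑ j : ι, ∑ k : ι, ∑ m : M, del (Pi.single j 1) (dbar (Pi.single k 1) (fun y ↦ ((‖W m y‖ ^ 2 : ℝ) : ℂ))) x * v j * conj (v k)
        = ∑ j : ι, ∑ m : M, ∑ k : ι, del (Pi.single j 1) (dbar (Pi.single k 1) (fun y ↦ ((‖W m y‖ ^ 2 : ℝ) : ℂ))) x * v j * conj (v k) :=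
          Finset.sum_congr rfl fun j _ ↦ Finset.sum_comm
      _ = ∑ m : M, ∑ j : ι, ∑ k : ι, del (Pi.single j 1) (dbar (Pi.single k 1) (fun y ↦ ((‖W m y‖ ^ 2 : ℝ) : ℂ))) x * v j * conj (v k) :=
          Finset.sum_comm
  rw [hswap, Complex.re_sum]
  exact Finset.sum_congr rfl fun m _ ↦ (hW m).re_levi_normSq x v

omit [Fintype M] in
/-- `D(proj_k)(v) = v_k`. [folklore] -/
theorem fderivF_proj_apply (k : ι) (x : D) (v : ι → ℂ) : fderivF (fun y ↦ D.proj y k) x v = v k := by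
  have : (fun y ↦ D.proj y k) = (fun z : ι → ℂ ↦ z k) ∘ D.proj := rfl
  rw [this, fderivF_comp_proj]
  have h1 : HasFDerivAt (fun z : ι → ℂ ↦ z k) ((ContinuousLinearMap.proj k : (ι → ℂ) →L[ℂ] ℂ).restrictScalars ℝ) (D.proj x) :=
    ((ContinuousLinearMap.proj k : (ι → ℂ) →L[ℂ] ℂ).restrictScalars ℝ).hasFDerivAt
  rw [h1.fderiv]
  rfl

/-- **Strict plurisubharmonicity of `s = ∑_m |W_m|²` when the coordinates are among the `W_m`**:
`Re ∑ s_{jk̄} v_j v̄_k ≥ |v|²`. [cite: HormanderSCV1973, Thm 5.4.2 ff. (the exhaustion of a Stein Riemann domain)] -/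
theorem re_levi_sum_normSq_ge [DecidableEq ι] (hW : ∀ m, IsFlatHolomorphic D (W m)) (c : ι ↪ M)
    (hc : ∀ k, W (c k) = fun y ↦ D.proj y k) (x : D) (v : ι → ℂ) :
    (1 : ℝ) * ∑ j, ‖v j‖ ^ 2 ≤
      (∑ j, ∑ k, del (Pi.single j 1) (dbar (Pi.single k 1) (fun y ↦ ((∑ m, ‖W m y‖ ^ 2 : ℝ) : ℂ))) x *
        v j * conj (v k)).re := by
  rw [re_levi_sum_normSq hW, one_mul]
  calc ∑ j, ‖v j‖ ^ 2 = ∑ j, ‖fderivF (W (c j)) x v‖ ^ 2 :=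
        Finset.sum_congr rfl fun j _ ↦ by rw [hc j, fderivF_proj_apply]
    _ = ∑ m ∈ Finset.univ.map c, ‖fderivF (W m) x v‖ ^ 2 := by rw [Finset.sum_map]
    _ ≤ ∑ m, ‖fderivF (W m) x v‖ ^ 2 :=
        Finset.sum_le_sum_of_subset_of_nonneg (Finset.subset_univ _) fun _ _ _ ↦ sq_nonneg _

/-- **Compact sublevel sets**: if `t ↦ (W_m t)_m` is proper, `{∑_m |W_m|² ≤ b}` is compact. [folklore] -/
theorem isCompact_sublevel_sum_normSq (hprop : IsProperMap fun (y : D) (m : M) ↦ W m y) (b : ℝ) :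
    IsCompact {y : D | ∑ m, ‖W m y‖ ^ 2 ≤ b} := by
  have hK : IsCompact {w : M → ℂ | ∑ m, ‖w m‖ ^ 2 ≤ b} := by
    refine Metric.isCompact_of_isClosed_isBounded (isClosed_le (by fun_prop) continuous_const) ?_
    refine (Metric.isBounded_closedBall (x := (0 : M → ℂ)) (r := Real.sqrt b)).subset fun w hw ↦ ?_
    rw [mem_closedBall, dist_zero_right, pi_norm_le_iff_of_nonneg (Real.sqrt_nonneg _)]
    intro m
    have hm : ‖w m‖ ^ 2 ≤ ∑ m, ‖w m‖ ^ 2 := Finset.single_le_sum (fun m _ ↦ sq_nonneg ‖w m‖) (Finset.mem_univ m)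
    have := Real.abs_le_sqrt (hm.trans hw)
    rwa [abs_norm] at this
  have hpre : {y : D | ∑ m, ‖W m y‖ ^ 2 ≤ b} = (fun (y : D) (m : M) ↦ W m y) ⁻¹' {w : M → ℂ | ∑ m, ‖w m‖ ^ 2 ≤ b} := rfl
  rw [hpre]
  exact hprop.isCompact_preimage hK

end Exhaustion

end RiemannDomain

end Literature.Analysis.Complex
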